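import Summits.ResolutionOfSingularities.ResolutionOfSingularities.Theorems.FrobeniusLadderFInjectiveMacaulayficationE8ChartYOriginNotClauseChar3
import Summits.ResolutionOfSingularities.ResolutionOfSingularities.Theorems.FrobeniusLadderFInjectiveMacaulayficationAffineBlowupStalkNotClause
import Summits.ResolutionOfSingularities.ResolutionOfSingularities.Theorems.FrobeniusLadderFInjectiveMacaulayficationE8Char5FiModel
import HarnessLib

/-!
# Crux `FInjectiveMacaulayfication`: calibration — in characteristic 3 the point blow-up does NOT
F-injectivize `E₈⁰` (line `Sketch`, cycle 6, wave 2)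

Support file for crux `stmt-ResolutionOfSingularities-15315` (`FrobeniusLadder.FInjectiveMacaulayfication`, route
`ResolutionOfSingularities/FrobeniusLadder`, rung 2), line `Sketch`, registered stub `stub_e8Char3PointBlowupNotFiModel`
(lead assembly of wave 2).

Cycle 5 certified (`E8Char5FiModel.stub_e8Char5FiModel`) that for every field `k` of characteristic `5` the blow-up
of `E₈⁰ = Spec k[X₀,X₁,X₂]/(X₂² + X₀³ + X₁⁵)` at its singular point is a proper birational model satisfying the
crux's stalk clause everywhere — F-injectivization WITHOUT resolution, by a non-parameter centre. Here the same
centre is shown to FAIL in characteristic `3`: the `y`-chart of `Bl_𝔪 E₈⁰` is the hypersurface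
`k[X]/(g_y)`, `g_y = X₂² + X₁X₀³ + X₁³` (`E8Forms.stub_e8Forms`, `StrictTransformChart.stub_strictTransformChart`,
both characteristic-free), whose origin — an `E₇⁰`-type point on the exceptional divisor — violates the clause in
characteristic `3` by Fedder's criterion (`g_y² ∈ (X₀³, X₁³, X₂³)`; `E8ChartYOriginNotClauseChar3.stub_e8ChartYOriginNotClauseChar3`);
transported to the chart ring and then to a stalk of `affineBlowup 𝔪`
(`AffineBlowupStalkNotClause.stub_affineBlowupStalkNotClause`). So the naive engine "blow up the non-F-injective
closed points" is characteristic-sensitive and must ITERATE (the crux cards' hand computations predict a second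
point blow-up suffices in characteristic 3): what a line for the open core still lacks is a measure that drops.

* `e8_origin_not_clause_char3` — `E₈⁰` itself violates the clause at the origin in characteristic `3`
  (`f² ∈ 𝔪^[3]`), so a modification IS needed;
* `stub_e8Char3PointBlowupNotFiModel` — the registered form: some stalk of `Bl_𝔪 E₈⁰ = affineBlowup 𝔪` violates
  the clause (characteristic `3`, every field).

References: R. Fedder, *F-purity and rational singularity*, Trans. AMS 278 (1983), Prop. 1.7, Thm. 1.12;
The Stacks Project, Tag 0804. [folklore]
-/

-- single-problem summit: the doubled namespace component is forced
set_option linter.dupNamespace false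

noncomputable section

namespace Summit.ResolutionOfSingularities.ResolutionOfSingularities.Theorems.FInjectiveMacaulayfication.E8Char3NotFiModel

open AlgebraicGeometry CategoryTheory Literature.AlgebraicGeometry.Resolution MvPolynomial
open Summit.ResolutionOfSingularities.ResolutionOfSingularities.Theorems.FInjectiveMacaulayfication

/-- `f² ∈ (X₀³, X₁³, X₂³)` for `f = X₂² + X₀³ + X₁⁵` (any commutative coefficient ring):
`f² = X₂·X₂³ + (2X₂² + X₀³ + 2X₁⁵)·X₀³ + (2X₂²X₁² + X₁⁷)·X₁³`. [folklore] -/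
theorem e8_sq_mem (k : Type) [CommRing k] :
    (X 2 ^ 2 + X 0 ^ 3 + X 1 ^ 5 : MvPolynomial (Fin 3) k) ^ (3 - 1) ∈
      Ideal.span (Set.range fun i : Fin 3 => (X i : MvPolynomial (Fin 3) k) ^ 3) := by
  have hX : ∀ i : Fin 3, (X i : MvPolynomial (Fin 3) k) ^ 3 ∈
      Ideal.span (Set.range fun i : Fin 3 => (X i : MvPolynomial (Fin 3) k) ^ 3) :=
    fun i => Ideal.subset_span ⟨i, rfl⟩
  have h : (X 2 ^ 2 + X 0 ^ 3 + X 1 ^ 5 : MvPolynomial (Fin 3) k) ^ (3 - 1) =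
      X 2 * X 2 ^ 3 + (2 * X 2 ^ 2 + X 0 ^ 3 + 2 * X 1 ^ 5) * X 0 ^ 3 +
        (2 * X 2 ^ 2 * X 1 ^ 2 + X 1 ^ 7) * X 1 ^ 3 := by
    norm_num
    ring
  rw [h]
  exact add_mem (add_mem (Ideal.mul_mem_left _ _ (hX 2)) (Ideal.mul_mem_left _ _ (hX 0)))
    (Ideal.mul_mem_left _ _ (hX 1))

/-- **`E₈⁰` violates the clause at the origin in characteristic `3`**: for a field `k` of characteristic `3`,
`S = k[X₀,X₁,X₂]`, `P = (X₀,X₁,X₂)`, the hypersurface local ring `S_P/(f)`, `f = X₂² + X₀³ + X₁⁵`, is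
Cohen–Macaulay but not F-injective: `f² ∈ 𝔪^[3]` (`e8_sq_mem`) and Fedder's criterion
(`FedderOrigin.fedder_criterion_origin`). [cite: Fedder1983, Thm. 1.12] -/
theorem e8_origin_not_clause_char3 (k : Type) [Field k] [CharP k 3] (P : Ideal (MvPolynomial (Fin 3) k))
    [P.IsMaximal] (hP : P = Ideal.span (Set.range (MvPolynomial.X : Fin 3 → MvPolynomial (Fin 3) k))) :
    ¬ (∀ d : ℕ, ringKrullDim (Localization.AtPrime P ⧸ Ideal.span {algebraMap (MvPolynomial (Fin 3) k)
        (Localization.AtPrime P) (X 2 ^ 2 + X 0 ^ 3 + X 1 ^ 5)}) = d →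
      ∀ s : Fin d → Localization.AtPrime P ⧸ Ideal.span {algebraMap (MvPolynomial (Fin 3) k)
          (Localization.AtPrime P) (X 2 ^ 2 + X 0 ^ 3 + X 1 ^ 5)},
        Ideal.IsMaximal (Ideal.radical (Ideal.span (Set.range s))) →
          RingTheory.Sequence.IsWeaklyRegular (Localization.AtPrime P ⧸ Ideal.span
              {algebraMap (MvPolynomial (Fin 3) k) (Localization.AtPrime P) (X 2 ^ 2 + X 0 ^ 3 + X 1 ^ 5)})
            (List.ofFn s) ∧
          ∀ y : Localization.AtPrime P ⧸ Ideal.span {algebraMap (MvPolynomial (Fin 3) k)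
              (Localization.AtPrime P) (X 2 ^ 2 + X 0 ^ 3 + X 1 ^ 5)},
            (∃ e : ℕ, y ^ 3 ^ e ∈ Ideal.span ((fun z : Localization.AtPrime P ⧸ Ideal.span
                {algebraMap (MvPolynomial (Fin 3) k) (Localization.AtPrime P) (X 2 ^ 2 + X 0 ^ 3 + X 1 ^ 5)}
                  => z ^ 3 ^ e) '' (Ideal.span (Set.range s) : Set (Localization.AtPrime P ⧸ Ideal.span
                {algebraMap (MvPolynomial (Fin 3) k) (Localization.AtPrime P)
                  (X 2 ^ 2 + X 0 ^ 3 + X 1 ^ 5)})))) →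
              y ∈ Ideal.span (Set.range s)) := by
  haveI : Fact (Nat.Prime 3) := ⟨Nat.prime_three⟩
  obtain ⟨⟨hfP, hf0⟩, -⟩ := E8Char5.forms_mem_and_ne_zero k
  rw [← hP] at hfP
  rw [Fedder.fedder_criterion_origin 3 k 3 P hP _ hfP hf0, not_not]
  exact e8_sq_mem k

/-- The Cohen–Macaulay + Frobenius-closed clause (exponent base `3`) FAILS at the origin of the `y`-chart
hypersurface `k[X]/(g_y)`, `g_y = X₂² + X₁X₀³ + X₁³`, in characteristic `3`: if it held at `(k[X]/(g_y))_{Q₀}`,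
`Q₀` the image of `P = (X₀,X₁,X₂)`, it would hold at `k[X]_P/(g_y) ≅ (k[X]/(g_y))_{Q₀}`
(`QuotLocalizationIso.stub_quotLocalizationIso`), contradicting `stub_e8ChartYOriginNotClauseChar3`.
[cite: Fedder1983, Thm. 1.12] -/
theorem gy_quotient_origin_not_clause (k : Type) [Field k] [CharP k 3]
    (P : Ideal (MvPolynomial (Fin 3) k)) [P.IsMaximal]
    (hP : P = Ideal.span (Set.range (MvPolynomial.X : Fin 3 → MvPolynomial (Fin 3) k)))
    (Q₀ : Ideal (MvPolynomial (Fin 3) k ⧸ Ideal.span {(X 2 ^ 2 + X 1 * X 0 ^ 3 + X 1 ^ 3 :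
      MvPolynomial (Fin 3) k)})) [Q₀.IsPrime]
    (hQ₀ : Q₀.comap (Ideal.Quotient.mk _) = P) :
    ¬ (∀ d : ℕ, ringKrullDim (Localization.AtPrime Q₀) = d → ∀ s : Fin d → Localization.AtPrime Q₀,
        (Ideal.span (Set.range s)).radical.IsMaximal →
          RingTheory.Sequence.IsWeaklyRegular (Localization.AtPrime Q₀) (List.ofFn s) ∧
          ∀ y : Localization.AtPrime Q₀, (∃ e : ℕ, y ^ 3 ^ e ∈ Ideal.span
            ((fun z : Localization.AtPrime Q₀ => z ^ 3 ^ e) ''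
              (Ideal.span (Set.range s) : Set (Localization.AtPrime Q₀)))) → y ∈ Ideal.span (Set.range s)) := by
  haveI : Fact (Nat.Prime 3) := ⟨Nat.prime_three⟩
  intro h
  obtain ⟨e⟩ := QuotLocalizationIso.stub_quotLocalizationIso (MvPolynomial (Fin 3) k)
    (X 2 ^ 2 + X 1 * X 0 ^ 3 + X 1 ^ 3) P Q₀ hQ₀
  exact E8ChartYOriginNotClauseChar3.stub_e8ChartYOriginNotClauseChar3 k P hP
    (DegreeZeroDescent.inlineClause_of_ringEquiv 3 e.symm h)

/-- Failure of the Cohen–Macaulay + Frobenius-closed clause at a prime transports along a ring isomorphism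
`e : B ≃+* A`: if it fails at `B_{Q₀}` then the full clause fails at `A_Q`, `Q = e(Q₀)` (`A_Q ≅ B_{Q₀}`,
`E8Char5FiModel.nonempty_ringEquiv_localization_comap`; `DegreeZeroDescent.inlineClause_of_ringEquiv`). Stated over
abstract rings so that the chart-ring instance paths never meet the unifier. [folklore] -/
theorem exists_prime_not_clause_of_ringEquiv (p : ℕ) {A B : Type} [CommRing A] [CommRing B] (e : B ≃+* A)
    (Q₀ : Ideal B) [Q₀.IsPrime]
    (h : ¬ (∀ d : ℕ, ringKrullDim (Localization.AtPrime Q₀) = d → ∀ s : Fin d → Localization.AtPrime Q₀,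
        (Ideal.span (Set.range s)).radical.IsMaximal →
          RingTheory.Sequence.IsWeaklyRegular (Localization.AtPrime Q₀) (List.ofFn s) ∧
          ∀ y : Localization.AtPrime Q₀, (∃ e : ℕ, y ^ p ^ e ∈ Ideal.span
            ((fun z : Localization.AtPrime Q₀ => z ^ p ^ e) ''
              (Ideal.span (Set.range s) : Set (Localization.AtPrime Q₀)))) → y ∈ Ideal.span (Set.range s))) :
    ∃ (Q : Ideal A) (_ : Q.IsPrime), ¬ (IsDomain (Localization.AtPrime Q) ∧
      ∀ d : ℕ, ringKrullDim (Localization.AtPrime Q) = d → ∀ s : Fin d → Localization.AtPrime Q,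
        (Ideal.span (Set.range s)).radical.IsMaximal →
          RingTheory.Sequence.IsWeaklyRegular (Localization.AtPrime Q) (List.ofFn s) ∧
          ∀ y : Localization.AtPrime Q, (∃ e : ℕ, y ^ p ^ e ∈ Ideal.span
            ((fun z : Localization.AtPrime Q => z ^ p ^ e) ''
              (Ideal.span (Set.range s) : Set (Localization.AtPrime Q)))) → y ∈ Ideal.span (Set.range s)) := by
  haveI : (Q₀.comap e.symm.toRingHom).IsPrime := Ideal.comap_isPrime _ Q₀
  refine ⟨Q₀.comap e.symm.toRingHom, inferInstance, ?_⟩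
  obtain ⟨eloc⟩ := E8Char5FiModel.nonempty_ringEquiv_localization_comap e.symm Q₀
  rintro ⟨-, h'⟩
  exact h (DegreeZeroDescent.inlineClause_of_ringEquiv p eloc h')

-- budget: the chart-ring types make unification on these statements expensive (≈ 3× default)
set_option maxHeartbeats 800000 in
/-- **CALIBRATION, negative half (registered stub `stub_e8Char3PointBlowupNotFiModel`): in characteristic 3 the
point blow-up of `E₈⁰` is NOT an F-injective model.** For every field `k` of characteristic `3`,
`R = k[X₀,X₁,X₂]/(X₂² + X₀³ + X₁⁵)` and `𝔪 = (x̄₀, x̄₁, x̄₂)`, some stalk of `Bl_𝔪(Spec R) = affineBlowup 𝔪`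
violates the crux's stalk clause (with exponent base `3`): the origin of the `y`-chart `k[X]/(g_y) ≅ R[𝔪/x̄₁]`
(`StrictTransformChart.stub_strictTransformChart` with `E8Forms.stub_e8Forms`), an `E₇⁰`-type point, fails
Fedder's test in characteristic `3` (`gy_quotient_origin_not_clause`), and chart-ring local rings are stalks of
the blow-up (`AffineBlowupStalkNotClause.stub_affineBlowupStalkNotClause`). Contrast characteristic `5`
(`E8Char5FiModel.stub_e8Char5FiModel`): the same centre works there. [cite: Fedder1983, Thm. 1.12] -/
theorem stub_e8Char3PointBlowupNotFiModel : ∀ (k : Type) [Field k] [CharP k 3] (f : MvPolynomial (Fin 3) k),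
    f = MvPolynomial.X 2 ^ 2 + MvPolynomial.X 0 ^ 3 + MvPolynomial.X 1 ^ 5 →
    ∀ (x : Fin 3 → MvPolynomial (Fin 3) k ⧸ Ideal.span {f}),
      x = (fun j : Fin 3 => Ideal.Quotient.mk (Ideal.span {f}) (MvPolynomial.X j)) →
      ∃ y : ↥(affineBlowup (Ideal.span (Set.range x))),
        ¬ (IsDomain ((affineBlowup (Ideal.span (Set.range x))).presheaf.stalk y) ∧
          ∀ d : ℕ, ringKrullDim ((affineBlowup (Ideal.span (Set.range x))).presheaf.stalk y) = d →
            ∀ s : Fin d → (affineBlowup (Ideal.span (Set.range x))).presheaf.stalk y,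
              (Ideal.span (Set.range s)).radical.IsMaximal →
              RingTheory.Sequence.IsWeaklyRegular ((affineBlowup (Ideal.span (Set.range x))).presheaf.stalk y)
                (List.ofFn s) ∧
              ∀ z : (affineBlowup (Ideal.span (Set.range x))).presheaf.stalk y, (∃ e : ℕ, z ^ 3 ^ e ∈
                  Ideal.span ((fun w : (affineBlowup (Ideal.span (Set.range x))).presheaf.stalk y => w ^ 3 ^ e) ''
                    (Ideal.span (Set.range s) :
                      Set ((affineBlowup (Ideal.span (Set.range x))).presheaf.stalk y)))) →
                z ∈ Ideal.span (Set.range s)) := by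
  intro k _ _ f hf x hx
  -- the forms: `f` prime and non-zero, `g_y` prime with `X₁ ∉ (g_y)`, `θ₁ f = X₁² g_y`
  obtain ⟨⟨hfp, hf0, -⟩, -, hgyp, hX1, hθ⟩ := E8Forms.stub_e8Forms k f
    (X 2 ^ 2 + X 0 + X 0 ^ 3 * X 1 ^ 5) (X 2 ^ 2 + X 1 * X 0 ^ 3 + X 1 ^ 3) hf rfl rfl
  -- the `y`-chart presentation `k[X]/(g_y) ≅ R[𝔪/x̄₁]`
  obtain ⟨e, -⟩ := StrictTransformChart.stub_strictTransformChart k f (X 2 ^ 2 + X 1 * X 0 ^ 3 + X 1 ^ 3) 1 2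
    hfp hf0 hgyp hX1 hθ x hx
  -- the origin of the chart: `Q₀ = P/(g_y)`, `P = (X₀, X₁, X₂)`
  haveI hPmax := Fedder.isMaximal_span_range_X k 3
  set P : Ideal (MvPolynomial (Fin 3) k) := Ideal.span (Set.range (MvPolynomial.X : Fin 3 → MvPolynomial (Fin 3) k))
    with hPdef
  have hgP : (X 2 ^ 2 + X 1 * X 0 ^ 3 + X 1 ^ 3 : MvPolynomial (Fin 3) k) ∈ P := (E8ChartYPoints.gy_mem_and_ne_zero k).1
  have hker : RingHom.ker (Ideal.Quotient.mk (Ideal.span {(X 2 ^ 2 + X 1 * X 0 ^ 3 + X 1 ^ 3 :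
      MvPolynomial (Fin 3) k)})) ≤ P := by
    rw [Ideal.mk_ker, Ideal.span_singleton_le_iff_mem]
    exact hgP
  obtain ⟨hQ₀max, hQ₀P⟩ := BlowupFiModel.isMaximal_map_and_comap_map_of_surjective
    (Ideal.Quotient.mk (Ideal.span {(X 2 ^ 2 + X 1 * X 0 ^ 3 + X 1 ^ 3 : MvPolynomial (Fin 3) k)}))
    Ideal.Quotient.mk_surjective P hker
  set Q₀ := P.map (Ideal.Quotient.mk (Ideal.span {(X 2 ^ 2 + X 1 * X 0 ^ 3 + X 1 ^ 3 : MvPolynomial (Fin 3) k)}))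
    with hQ₀def
  haveI := hQ₀max
  have hnot₀ := gy_quotient_origin_not_clause k P rfl Q₀ hQ₀P
  -- transport to the chart ring along `e`: `Q = e(Q₀)`, `A_Q ≅ (k[X]/(g_y))_{Q₀}`
  -- (elaborate the transported failure WITHOUT the goal as expected type, then close by `exact`)
  have key := exists_prime_not_clause_of_ringEquiv
    (A := HomogeneousLocalization.Away (reesGrading (Ideal.span (Set.range x)))
      (reesT (x 1) (Ideal.subset_span (Set.mem_range_self 1))))
    (B := MvPolynomial (Fin 3) k ⧸ Ideal.span {(X 2 ^ 2 + X 1 * X 0 ^ 3 + X 1 ^ 3 : MvPolynomial (Fin 3) k)})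
    3 e Q₀ hnot₀
  obtain ⟨Q, hQ, hnot⟩ := key
  haveI := hQ
  exact AffineBlowupStalkNotClause.stub_affineBlowupStalkNotClause 3 (MvPolynomial (Fin 3) k ⧸ Ideal.span {f})
    (Ideal.span (Set.range x)) (x 1) (Ideal.subset_span (Set.mem_range_self 1)) Q hnot

end Summit.ResolutionOfSingularities.ResolutionOfSingularities.Theorems.FInjectiveMacaulayfication.E8Char3NotFiModel

end
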